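import Summits.QuantumFields.YangMills.Theorems.BalabanLadderUVSeamRecColdWallCentreOfExtremal
import HarnessLib

/-!
# Rung for LINE «slack_coldwall» (crux `BalabanLadder.UVSeamRec`, stmt-QuantumFields-20043) — ideator ym-idea-10 g3

Sorry-free.  The one-sided slack cold-wall ceiling (SCW) of `Cruxes/UVSeamRec/Lines/slack_coldwall.lean` AT A POINT — `kerE^η(plane q x) ≤ kerE^𝟙(plane q x) + a`
for every exterior `η` of the cube `(x − R − 1, 2R+3)`, with an allowance `a` (in the line `a = κ/R⁴`) — already puts the cold-wall centre DEFICIT below the torus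
mean up to the allowance, for every compact `G`, representation `r`, `β` and odd torus of half-side `L ≥ R + 2`:

* `kerE_one_deficit_le_torusE_add_of_slack` : (SCW at `(β,R,q,x)` with allowance `a`) ⇒ `kerE^𝟙(N − plane q x) ≤ ⟨N − plane q x⟩_{2L+1,β} + a`;
* `kerE_one_deficit_le_add_of_slack` (`SU(2)`, `β ≥ 2`) : ⇒ `kerE^𝟙_{β,R}(2 − plane q x) ≤ 29/β + a`, uniformly in `R` —

i.e. Tier 3 of the tempered-d1 memo «up to the allowance», exactly as announced in the line card.  This is the `a`-slack version of the LEAD's (gen 12)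
`ColdWall.kerE_one_deficit_le_torusE_of_extremal` / `kerE_one_deficit_le_of_extremal` (the case `a = 0` = line «extremal_coldwall»'s (CWX)), and the proof is
theirs plus one `torusE_const`/`torusE_add'` step.  A rung, not a stub: nothing about the crux, the route, E0′, NT or Clay is claimed.
-/

open MeasureTheory
open Literature.MathematicalPhysics.QuantumFieldTheory (LatticeRep isProbabilityMeasure_wilsonMeasure)
open Literature.MathematicalPhysics.QuantumLattice (fundamentalLatticeRep LGConfig)
open Summit.QuantumFields.YangMills.Cruxes.OSLegsFromFemtoAndGap.DlrCollarTransfer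
open Summit.QuantumFields.YangMills.Cruxes.UVSeamRec
open Summit.QuantumFields.YangMills.Cruxes.UVSeamRec.ClassicalResponse

namespace Summit.QuantumFields.YangMills.Cruxes.UVSeamRec.SlackColdWall.Rung

section General

variable (G : Type) [Group G] [TopologicalSpace G] [IsTopologicalGroup G] [CompactSpace G] [MeasurableSpace G] [BorelSpace G]
  (r : LatticeRep G)

/-- **Slack cold-wall ceiling at a point ⇒ cold-wall centre deficit below the torus mean, up to the allowance.**  If every exterior's kernel mean of
`plane q x` is at most the cold wall's plus `a`, then `kerE^{𝟙}(N − plane q x) ≤ ⟨N − plane q x⟩_{2L+1,β} + a` on every odd torus with `R + 2 ≤ L`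
(torus DLR through the cube, monotonicity of the torus state, continuity of the kernel mean in the exterior). [folklore: Georgii (2011) Thm. 4.17] -/
theorem kerE_one_deficit_le_torusE_add_of_slack (β : ℝ) (R L : ℕ) (hRL : R + 2 ≤ L) (q : Fin 4 × Fin 4) (x : Fin 4 → ℤ) (a : ℝ)
    (hSCW : ∀ η : LGConfig 4 G, kerE G r β (fun k => x k - (R + 1)) (2 * R + 3) η (plane G r q x) ≤
      kerE G r β (fun k => x k - (R + 1)) (2 * R + 3) (fun _ => 1) (plane G r q x) + a) :
    kerE G r β (fun k => x k - (R + 1)) (2 * R + 3) (fun _ => 1) (fun U => (r.N : ℝ) - plane G r q x U) ≤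
      torusE G r β L (fun U => (r.N : ℝ) - plane G r q x U) + a := by
  obtain ⟨C, hC⟩ := exists_abs_plane_le (G := G) r
  have hcont : Continuous fun η : LGConfig 4 G => kerE G r β (fun k => x k - (R + 1)) (2 * R + 3) η (plane G r q x) :=
    NT.Reference.continuous_kerE G r β _ _ (continuous_plane r q x) (hC q x)
  have hDLR := ResponsePinning.torusE_plane_eq_torusE_kerE (G := G) r β q x R L hRL
  have hmono : torusE G r β L (fun η => kerE G r β (fun k => x k - (R + 1)) (2 * R + 3) η (plane G r q x)) ≤
      torusE G r β L (fun _ => kerE G r β (fun k => x k - (R + 1)) (2 * R + 3) (fun _ => 1) (plane G r q x) + a) :=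
    ResponsePinning.torusE_mono r β L hcont continuous_const hSCW
  rw [ResponsePinning.torusE_const, ← hDLR] at hmono
  rw [kerE_const_sub r β _ _ _ (continuous_plane r q x), ColdWall.torusE_const_sub G r β L (continuous_plane r q x)]
  linarith

end General

/-- **(SCW) ⇒ the R-uniform cold-wall centre ceiling up to the allowance (`SU(2)`).**  For `β ≥ 2`, every `R`, `q.1 < q.2`, `x` and allowance `a`: the slack
cold-wall ceiling at this point gives `kerE^{𝟙}_{β,R}(2 − plane q x) ≤ 29/β + a` (the LEAD's torus ceiling on the odd torus of half-side `R + 2 + ⌈β⌉₊`).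
With `a = κ/R⁴` this is Tier 3 «up to `κ/R⁴`» for line «slack_coldwall». [folklore] -/
theorem kerE_one_deficit_le_add_of_slack {β : ℝ} (hβ : 2 ≤ β) (R : ℕ) (q : Fin 4 × Fin 4) (hq : q.1 < q.2) (x : Fin 4 → ℤ) (a : ℝ)
    (hSCW : ∀ η : LGConfig 4 (Matrix.specialUnitaryGroup (Fin 2) ℂ),
      kerE (Matrix.specialUnitaryGroup (Fin 2) ℂ) (fundamentalLatticeRep 2) β (fun k => x k - (R + 1)) (2 * R + 3) η
          (plane (Matrix.specialUnitaryGroup (Fin 2) ℂ) (fundamentalLatticeRep 2) q x) ≤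
        kerE (Matrix.specialUnitaryGroup (Fin 2) ℂ) (fundamentalLatticeRep 2) β (fun k => x k - (R + 1)) (2 * R + 3) (fun _ => 1)
          (plane (Matrix.specialUnitaryGroup (Fin 2) ℂ) (fundamentalLatticeRep 2) q x) + a) :
    kerE (Matrix.specialUnitaryGroup (Fin 2) ℂ) (fundamentalLatticeRep 2) β (fun k => x k - (R + 1)) (2 * R + 3) (fun _ => 1)
        (fun U => 2 - plane (Matrix.specialUnitaryGroup (Fin 2) ℂ) (fundamentalLatticeRep 2) q x U) ≤ 29 / β + a := by
  set L : ℕ := R + 2 + ⌈β⌉₊ with hL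
  have hRL : R + 2 ≤ L := by omega
  have hL1 : 1 ≤ L := by omega
  have hlog : Real.log β ≤ (2 * L + 1 : ℕ) := by
    have h1 : Real.log β ≤ β := (Real.log_le_sub_one_of_pos (by linarith)).trans (by linarith)
    have h2 : β ≤ ⌈β⌉₊ := Nat.le_ceil β
    have h3 : ((⌈β⌉₊ : ℕ) : ℝ) ≤ (2 * L + 1 : ℕ) := by
      have : ⌈β⌉₊ ≤ 2 * L + 1 := by omega
      exact_mod_cast this
    linarith
  have h := kerE_one_deficit_le_torusE_add_of_slack (Matrix.specialUnitaryGroup (Fin 2) ℂ) (fundamentalLatticeRep 2) β R L hRL q x a hSCW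
  have hN : ((fundamentalLatticeRep 2).N : ℝ) = 2 := by simp
  simp only [hN] at h
  have htorus := ThermalFloor.torusE_two_sub_plane_le_of_log_le hβ hL1 hlog q hq x
  rw [ColdWall.torusE_const_sub _ (fundamentalLatticeRep 2) β L (continuous_plane (fundamentalLatticeRep 2) q x)] at h
  linarith

/-- The skeleton's (SCW) shape (exterior written `1`, allowance `κ / R⁴`) feeds the rung verbatim: under `stub_slackColdWall`'s conclusion at `(β, R, q, x)`,
`kerE^{𝟙}_{β,R}(2 − plane q x) ≤ 29/β + κ/R⁴` for `β ≥ 2`. -/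
theorem kerE_one_deficit_le_of_stubShape {β κ : ℝ} (hβ : 2 ≤ β) (R : ℕ) (q : Fin 4 × Fin 4) (hq : q.1 < q.2) (x : Fin 4 → ℤ)
    (hSCW : ∀ η : LGConfig 4 (Matrix.specialUnitaryGroup (Fin 2) ℂ),
      kerE (Matrix.specialUnitaryGroup (Fin 2) ℂ) (fundamentalLatticeRep 2) β (fun k => x k - (R + 1)) (2 * R + 3) η
          (plane (Matrix.specialUnitaryGroup (Fin 2) ℂ) (fundamentalLatticeRep 2) q x) ≤
        kerE (Matrix.specialUnitaryGroup (Fin 2) ℂ) (fundamentalLatticeRep 2) β (fun k => x k - (R + 1)) (2 * R + 3) 1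
          (plane (Matrix.specialUnitaryGroup (Fin 2) ℂ) (fundamentalLatticeRep 2) q x) + κ / (R : ℝ) ^ 4) :
    kerE (Matrix.specialUnitaryGroup (Fin 2) ℂ) (fundamentalLatticeRep 2) β (fun k => x k - (R + 1)) (2 * R + 3) 1
        (fun U => 2 - plane (Matrix.specialUnitaryGroup (Fin 2) ℂ) (fundamentalLatticeRep 2) q x U) ≤ 29 / β + κ / (R : ℝ) ^ 4 :=
  kerE_one_deficit_le_add_of_slack hβ R q hq x (κ / (R : ℝ) ^ 4) hSCW

end Summit.QuantumFields.YangMills.Cruxes.UVSeamRec.SlackColdWall.Rung
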